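import Summits.BirchSwinnertonDyer.BirchSwinnertonDyer.Theorems.Rank1ResidualJetSelmerLemmas
import HarnessLib

/-!
# Two bookkeeping conjuncts of the walk's supply, supplied: the sign function `ε(m) = ε·(−1)^{#primes of m}`
# and the carrier places over a prime `q ∣ N` (cell `bsd-stepL`, seat `bsd-stepL-tam3-p1`, helper toward
# item 19109 `EulerHalvesAtThree`, registered stub `stub_jetchevMaxHLAtThree`)

HONEST FRAMING. Nothing here proves BSD, J₃ or any divisibility; the registered stub is NOT discharged;
no item closes; 0 classes move (T7); `--supports stmt-BirchSwinnertonDyer-19109` (helper). WHAT THIS FILE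
DOES. Two of the conjuncts of `hsupply` in `Koly.jetchevMaxHLAtThree_of_facts_of_supply` (p504978) are
pure bookkeeping and are discharged here once and for all: `exists_signFunction` — for `ε = ±1` there is
`eb : ℕ → Bool` with `eb (mℓ) = !eb m` for primes `ℓ ∤ m` (`heb`) and `(if eb m then 1 else −1) =
ε·(−1)^{#primeFactors m}` (`hebε`) ([J] §3.1 item 6: `ε(c) = ε·(−1)^{f(c)}`; Gross Prop. 5.4:
`ε_n = ε·(−1)^{f_n}`); `natCast_mem_of_mem_placesDividing_of_dvd` — the places of `K` dividing a prime
`q ∣ N` contain `N` (`hQcar` for `Qcar := placesDividing K q`).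
References (locators only; no cited FACT declared): [cite: Jetchev2008, §3.1 item 6 (p. 817)]
[cite: GrossLMS1991, Prop. 5.4]. Design: theorems only; `K : Type`. Axioms: `propext`,
`Classical.choice`, `Quot.sound`.
-/

set_option autoImplicit false

noncomputable section

open scoped Classical NumberField

namespace Summit.BirchSwinnertonDyer.Rank1Residual.JET.Walk

open IsDedekindDomain NumberField Literature.NumberTheory.EllipticCurves.Jetchev2008

/-- **The sign function of the walk exists**: for `ε = ±1`, `eb m := (ε·(−1)^{#primeFactors m} = 1)`
flips along `m ↦ mℓ` for a new prime `ℓ` and realises `ε·(−1)^{#primes}` — the conjuncts `heb`, `hebε`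
of the supply. Elementary. [cite: Jetchev2008, §3.1 item 6 (p. 817)] [cite: GrossLMS1991, Prop. 5.4] -/
theorem exists_signFunction (ε : ℤ) (hε : ε = 1 ∨ ε = -1) :
    ∃ eb : ℕ → Bool, (∀ (m ℓ : ℕ), ℓ.Prime → ¬ ℓ ∣ m → eb (m * ℓ) = !eb m) ∧
      ∀ m : ℕ, (if eb m then (1 : ℤ) else -1) = ε * (-1) ^ m.primeFactors.card := by
  refine ⟨fun m ↦ decide (ε * (-1) ^ m.primeFactors.card = 1), fun m ℓ hℓ hℓm ↦ ?_, fun m ↦ ?_⟩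
  · have hm : m ≠ 0 := fun h ↦ hℓm (h ▸ dvd_zero ℓ)
    have hcard : (m * ℓ).primeFactors.card = m.primeFactors.card + 1 := by
      rw [Nat.primeFactors_mul hm hℓ.ne_zero, hℓ.primeFactors, Finset.union_comm,
        ← Finset.insert_eq, Finset.card_insert_of_notMem]
      exact fun h ↦ hℓm (Nat.dvd_of_mem_primeFactors h)
    simp only [hcard, pow_succ, mul_neg, mul_one]
    rcases hε with rfl | rfl <;>
      rcases neg_one_pow_eq_or ℤ m.primeFactors.card with h | h <;> simp [h]
  · by_cases h : ε * (-1) ^ m.primeFactors.card = 1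
    · simp [h]
    · have h' : ε * (-1) ^ m.primeFactors.card = -1 := by
        rcases hε with rfl | rfl <;>
          rcases neg_one_pow_eq_or ℤ m.primeFactors.card with h1 | h1 <;> simp_all
      simp [h']

/-- **The carrier places contain `N`**: for a prime `q ∣ N`, every place of `K` dividing `q` contains
`N` — the conjunct `hQcar` of the supply for `Qcar := placesDividing K q`. Elementary.
[cite: Jetchev2008, §3.3.2 (p. 816) (the places v ∣ q)] -/
theorem natCast_mem_of_mem_placesDividing_of_dvd {K : Type} [Field K] [NumberField K] {q N : ℕ}
    (hq : q ≠ 0) (hqN : q ∣ N) :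
    ∀ v ∈ placesDividing K q, (N : 𝓞 K) ∈ v.asIdeal := by
  intro v hv
  rw [SelmerVocabulary.mem_placesDividing_iff_natCast_mem hq] at hv
  obtain ⟨d, rfl⟩ := hqN
  rw [Nat.cast_mul]
  exact v.asIdeal.mul_mem_right _ hv

end Summit.BirchSwinnertonDyer.Rank1Residual.JET.Walk

end
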